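import Literature.AlgebraicGeometry.Resolution.LocalBlowup
import Literature.AlgebraicGeometry.Resolution.DerivationCompletion
import Literature.AlgebraicGeometry.Resolution.DualDerivationsPrimeField
import Literature.FieldTheory.Separability.PIndependentDerivations
import Literature.FieldTheory.Separability.DerivationAlgebraic
import Summits.ResolutionOfSingularities.ResolutionOfSingularities.Theorems.ValuativeLuAlphaPTorsorLocAtCentreDerivations
import Mathlib.FieldTheory.SeparablyGenerated
import Mathlib.RingTheory.AlgebraicIndependent.TranscendenceBasis
import HarnessLib

/-!
# Crux `FolLU` (stmt-ResolutionOfSingularities-17081), line `birth` — stub `stub_valSpan`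

Route `ResolutionOfSingularities/FoliationDescent`, the low-dimensional engine. **(VAL) at the
centre of a finitely generated model of a function field of transcendence degree `≤ 2` over a
perfect field**: for `k` perfect of characteristic `p`, `K/k` finitely generated (`S ≤ O` a
finitely generated `k`-subalgebra with `Frac S = K`) with `trdeg_k K ≤ 2`, `R = S_c =
locAtCentre S O` regular of dimension two with `𝔪_R = (x, y)`, and `D` a `k`-derivation of `K`:
`D(f) ∈ R·D(x) + R·D(y)` for every `f ∈ R`; precisely `D = D(x)·∂₁ + D(y)·∂₂` on `R` for the
derivations `∂₁, ∂₂` of `R` dual to `(x, y)`.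

Proof.
* `∂₁, ∂₂ ∈ Der_ℤ(R)` with `∂ᵢ(x) = δᵢ₁`, `∂ᵢ(y) = δᵢ₂` exist by
  `exists_dual_derivations_locAtCentre` (`…ValuativeLuAlphaPTorsorLocAtCentreDerivations.lean`:
  `R` is a localisation of a polynomial ring quotient, regular, and the classes of `x, y` form a
  basis of `𝔪/𝔪²`), and extend to `ℤ`-derivations `∂̂ᵢ` of `K = Frac R`
  (`exists_derivation_extend_of_isLocalizedModule`, `DerivationCompletion.lean`).
* `dim_K Der_ℤ(K, K) ≤ 2` (`finite_and_finrank_derivation_le`): `K/k` has a separating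
  transcendence basis `s` with `#s = trdeg ≤ 2` (Mathlib's
  `exists_isTranscendenceBasis_and_isSeparable_of_perfectField`), and a `ℤ`-derivation of `K` is
  determined by its values on `s`: it kills `k = k^p` (`derivation_algebraMap_eq_zero`), hence
  the subfield `k(s)`, hence `K` by separability (`Derivation.eq_zero_of_forall_algebraMap_eq_zero`,
  `DerivationAlgebraic.lean`).
* `∂̂₁, ∂̂₂` are `K`-linearly independent (evaluate at `x, y`), hence a basis of `Der_ℤ(K, K)`, and
  the coordinates of `D` in it are `D(x), D(y)` (evaluate at `x, y` again). For `f ∈ R` this reads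
  `D(f) = D(x)·∂₁(f) + D(y)·∂₂(f)` with `∂ᵢ(f) ∈ R`.
(In particular `K = K^p(x, y)`, the formulation of the lead's plan, is a COROLLARY rather than an
ingredient: no `p`-independence computation modulo `x` is needed.)

References: H. Matsumura, *Commutative Ring Theory*, CUP 1986, Thm. 30.6 (ii) (dual derivations)
and §26 (derivations of separably generated extensions) [Matsumura1987]; J. Giraud, *Forme
normale d'une fonction sur une surface de caractéristique positive*, Bull. SMF 111 (1983), 1.1
[Giraud1983].
-/

set_option linter.dupNamespace false -- mandated namespace of this single-conjunct summit

noncomputable section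

namespace Summit.ResolutionOfSingularities.ResolutionOfSingularities.Theorems.FolLU

namespace ValSpan

open IsLocalRing Literature.AlgebraicGeometry.Resolution Literature.FieldTheory.Separability

variable {k K : Type} [Field k] [Field K] [Algebra k K]

/-! ## `ℤ`-derivations of a finitely generated extension of a perfect field -/

/-- A `ℤ`-derivation of a field extension `K` of a perfect field `k` of characteristic `p` kills
`k` (every element of `k` is a `p`-th power). [folklore] -/
theorem derivation_algebraMap_eq_zero (p : ℕ) [Fact p.Prime] [CharP k p] [PerfectField k]
    (D : Derivation ℤ K K) (c : k) : D (algebraMap k K c) = 0 := by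
  haveI : ExpChar k p := ExpChar.prime Fact.out
  haveI : CharP K p := charP_of_injective_algebraMap (algebraMap k K).injective p
  obtain ⟨d, rfl⟩ := (frobeniusEquiv k p).surjective c
  rw [frobeniusEquiv_apply, frobenius_def, map_pow]
  exact Derivation.apply_pow_char D _

/-- A `ℤ`-derivation of `K` vanishing on a set `s` over which `K/k(s)` is separable algebraic
(`k` perfect of characteristic `p`) vanishes: it kills `k` and `s`, hence the subfield `k(s)`,
hence `K`. [folklore] -/
theorem derivation_eq_zero_of_forall_mem (p : ℕ) [Fact p.Prime] (k : Type) [Field k]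
    [Algebra k K] [CharP k p] [PerfectField k] (s : Set K)
    [Algebra.IsSeparable (IntermediateField.adjoin k s) K] (D : Derivation ℤ K K)
    (h : ∀ x ∈ s, D x = 0) : D = 0 := by
  have h1 : Set.EqOn D (0 : Derivation ℤ K K)
      (Subfield.closure (Set.range (algebraMap k K) ∪ s) : Set K) := by
    apply Derivation.eqOn_subfieldClosure
    rintro x (⟨c, rfl⟩ | hx)
    · exact derivation_algebraMap_eq_zero p D c
    · exact h x hx
  refine Derivation.eq_zero_of_forall_algebraMap_eq_zero (F := IntermediateField.adjoin k s) D
    fun a => ?_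
  have ha : (a : K) ∈ (Subfield.closure (Set.range (algebraMap k K) ∪ s) : Set K) := by
    rw [SetLike.mem_coe, ← IntermediateField.adjoin_toSubfield]
    exact a.2
  exact h1 ha

/-- **`dim_K Der_ℤ(K, K) ≤ trdeg_k K`** for a finitely generated extension `K` of a perfect field
`k` of characteristic `p`: the `ℤ`-derivations `K → K` form a finite-dimensional `K`-vector
space of dimension `≤ n` whenever `trdeg_k K ≤ n`, being determined by their values on a
separating transcendence basis (which exists: Mathlib's
`exists_isTranscendenceBasis_and_isSeparable_of_perfectField`). [folklore] -/
theorem finite_and_finrank_derivation_le (p : ℕ) [Fact p.Prime] [CharP k p] [PerfectField k]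
    [Algebra.EssFiniteType k K] (n : ℕ) (htr : Algebra.trdeg k K ≤ n) :
    Module.Finite K (Derivation ℤ K K) ∧ Module.finrank K (Derivation ℤ K K) ≤ n := by
  obtain ⟨s, hs, hsep⟩ := exists_isTranscendenceBasis_and_isSeparable_of_perfectField k K
  -- evaluation on the separating transcendence basis `s` is injective
  let ev : Derivation ℤ K K →ₗ[K] (s → K) :=
    { toFun := fun D i => D (i : K)
      map_add' := fun D₁ D₂ => rfl
      map_smul' := fun c D => rfl }
  have hinj : Function.Injective ev := by
    intro D₁ D₂ hD
    rw [← sub_eq_zero]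
    refine derivation_eq_zero_of_forall_mem p k (s : Set K) (D₁ - D₂) fun x hx => ?_
    have := congr_fun hD ⟨x, hx⟩
    rw [Derivation.sub_apply, sub_eq_zero]
    exact this
  haveI : Module.Finite K (Derivation ℤ K K) := Module.Finite.of_injective ev hinj
  refine ⟨this, ?_⟩
  have h1 := LinearMap.finrank_le_finrank_of_injective hinj
  rw [Module.finrank_fintype_fun_eq_card, Fintype.card_coe] at h1
  -- `#s = trdeg ≤ n`
  have h2 : s.card ≤ n := by
    have h3 := hs.cardinalMk_eq_trdeg
    rw [Cardinal.mk_coe_finset] at h3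
    have h4 : (s.card : Cardinal) ≤ n := h3 ▸ htr
    exact_mod_cast h4
  omega

end ValSpan

open Literature.AlgebraicGeometry.Resolution IsLocalRing
open Summit.ResolutionOfSingularities.ResolutionOfSingularities.Theorems.PfaffLine

/-- **(VAL) at the centre of a finitely generated model of a function field of transcendence
degree two over a perfect field.** `k` perfect of characteristic `p`, `K/k` with
`Algebra.trdeg k K ≤ 2`, `S ≤ O` f.g. with `Frac S = K`, `R = S_c = locAtCentre S O` regular of
dimension two with `𝔪_R = (x, y)`, `D` a `k`-derivation of `K`: then
`D(f) ∈ R·D(x) + R·D(y)` for all `f ∈ R`. Proof: `R` carries `ℤ`-derivations `∂₁, ∂₂` dual to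
`(x, y)` (`exists_dual_derivations_locAtCentre`), which extend to `K = Frac R`; as `K/k` is
separably generated of transcendence degree `≤ 2` over the perfect `k`, `dim_K Der_ℤ(K, K) ≤ 2`
(`ValSpan.finite_and_finrank_derivation_le`), so the two extensions, being independent, form a
basis of `Der_ℤ(K, K)` in which `D` has coordinates `D(x), D(y)`:
`D = D(x)·∂₁ + D(y)·∂₂` on `R`. [cite: Matsumura1987, Thm. 30.6 (ii)] -/
theorem stub_valSpan :
    ∀ p : ℕ, p.Prime → ∀ (k K : Type) [Field k] [CharP k p] [PerfectField k] [Field K] [Algebra k K]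
    (O : ValuationSubring K) (S : Subalgebra k K), S.toSubring ≤ O.toSubring →
    ∀ (D : Derivation k K K), S.FG → IsFractionRing S K → Algebra.trdeg k K ≤ 2 →
    ∀ [IsRegularLocalRing (locAtCentre S.toSubring O)],
    ringKrullDim (locAtCentre S.toSubring O) = 2 →
    ∀ (x y : locAtCentre S.toSubring O),
    maximalIdeal (locAtCentre S.toSubring O) = Ideal.span {x, y} →
    ∀ f : locAtCentre S.toSubring O, ∃ a b : locAtCentre S.toSubring O,
      D (f : K) = (a : K) * D (x : K) + (b : K) * D (y : K) := by
  intro p hp k K _ _ _ _ _ O S hSO D hfg hfrac htr _ hdim x y hmax f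
  haveI : Fact p.Prime := ⟨hp⟩
  -- (1) dual derivations of `R = S_c` for the regular system of parameters `(x, y)`
  obtain ⟨δ, hδ⟩ := exists_dual_derivations_locAtCentre p k K O S hSO hfg ![x, y]
    (by rw [Matrix.range_cons_cons_empty, hmax]) (by rw [hdim]; rfl)
  -- (2) `K = Frac R`; extend the `δ i` to `ℤ`-derivations `δ' i` of `K`
  haveI : IsFractionRing (locAtCentre S.toSubring O) K := by
    refine IsFractionRing.of_field _ K fun z => ?_
    obtain ⟨a, b, -, rfl⟩ := IsFractionRing.div_surjective (A := S) z
    exact ⟨⟨a, le_locAtCentre _ O a.2⟩, ⟨b, le_locAtCentre _ O b.2⟩, rfl⟩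
  have hext : ∀ i, ∃ δ' : Derivation ℤ K K, ∀ r : locAtCentre S.toSubring O,
      δ' (r : K) = (δ i r : K) := fun i =>
    exists_derivation_extend_of_isLocalizedModule (nonZeroDivisors (locAtCentre S.toSubring O)) K
      (Algebra.linearMap (locAtCentre S.toSubring O) K) (δ i)
  choose δ' hδ' using hext
  have hδ'u : ∀ i j, δ' i ((![x, y] j : locAtCentre S.toSubring O) : K) = if i = j then 1 else 0 :=
    fun i j => by
    rw [hδ', hδ i j]
    split_ifs <;> rfl
  -- (3) `dim_K Der_ℤ(K, K) ≤ 2`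
  haveI : Algebra.FiniteType k S := (Subalgebra.fg_iff_finiteType S).mp hfg
  haveI : Algebra.EssFiniteType S K :=
    Algebra.EssFiniteType.of_isLocalization K (nonZeroDivisors S)
  haveI : Algebra.EssFiniteType k K := Algebra.EssFiniteType.comp k S K
  obtain ⟨hfin, hrank⟩ :=
    ValSpan.finite_and_finrank_derivation_le (K := K) p 2 (by exact_mod_cast htr)
  -- (4) the `δ' i` are linearly independent (evaluate at `x, y`), hence a basis
  have hli : LinearIndependent K δ' := by
    rw [Fintype.linearIndependent_iff]
    intro g hg i
    have := congr_arg
      (fun E : Derivation ℤ K K => E ((![x, y] i : locAtCentre S.toSubring O) : K)) hg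
    simp only [derivation_sum_apply, Derivation.smul_apply, smul_eq_mul, hδ'u,
      mul_ite, mul_one, mul_zero, Finset.sum_ite_eq', Finset.mem_univ, if_true,
      Derivation.zero_apply] at this
    exact this
  have hcard : Fintype.card (Fin 2) = Module.finrank K (Derivation ℤ K K) :=
    le_antisymm hli.fintype_card_le_finrank (by simpa using hrank)
  let b := basisOfLinearIndependentOfCardEqFinrank hli hcard
  -- (5) the coordinates of `D` in this basis are `D x`, `D y`
  let c : Fin 2 → K := fun i => b.repr (D.restrictScalars ℤ) i
  have hD : ∀ z : K, D z = ∑ i, c i * δ' i z := fun z => by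
    have h1 := b.sum_repr (D.restrictScalars ℤ)
    have h2 := congr_arg (fun E : Derivation ℤ K K => E z) h1
    simp only [derivation_sum_apply, Derivation.smul_apply, smul_eq_mul, b,
      coe_basisOfLinearIndependentOfCardEqFinrank] at h2
    exact h2.symm
  have hcu : ∀ j, c j = D ((![x, y] j : locAtCentre S.toSubring O) : K) := fun j => by
    rw [hD]
    simp only [hδ'u, mul_ite, mul_one, mul_zero, Finset.sum_ite_eq', Finset.mem_univ, if_true]
  -- (6) on `R` the `δ' i` take values in `R`
  refine ⟨δ 0 f, δ 1 f, ?_⟩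
  rw [hD, Fin.sum_univ_two, hcu 0, hcu 1, hδ', hδ']
  simp only [Matrix.cons_val_zero, Matrix.cons_val_one]
  ring

end Summit.ResolutionOfSingularities.ResolutionOfSingularities.Theorems.FolLU
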